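import Mathlib
import Summits.NavierStokesRegularity.NavierStokesRegularity.Theorems.EulerZoomLiouvillePowerGaugeEulerLiouvilleNeedleWaitingTime
import Summits.NavierStokesRegularity.NavierStokesRegularity.Theorems.EulerZoomLiouvillePowerGaugeEulerLiouvilleNeedleThinFastExits
import Summits.NavierStokesRegularity.NavierStokesRegularity.Theorems.EulerZoomLiouvillePowerGaugeEulerLiouvilleNeedleRaceMember
import HarnessLib.Audit

/-!
# Crux E `EulerZoomLiouville.PowerGaugeEulerLiouville` — THE GENERAL-3-D WAITING-TIME LAW AND THE LOG-CLOCK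
# THRESHOLD AT MEMBER LEVEL (ROUND-38 (W), (T_log) ∘ (K′)): no symmetry

Route №10 `EulerZoomLiouville` (NavierStokesRegularity), crux E = stmt-NavierStokesRegularity-19832, registered residue
`stub_selfSimilarC2Needle` (THE ONE STATEMENT); memo ROUND-38 «THE WAITING-TIME EXPONENT» of the cell `ns-regularity-ideate`
(text custody nsreg-p2 g33).  By-name assembly of (K′) = Lemma K WITHOUT SYMMETRY (nsreg-p2 t39b/t39c,
`NeedleFastSetMeasure.thinFastExits`: every `C¹` field with polynomial ball budgets has super-polynomially thin fast exits)
with this seat's symmetry-free exit law and threshold (`…NeedleWaitingTime`), the budgets being read off the class gauges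
(`NeedleThinCore.selfSimilar_needle_inputs`, `NeedleRace.lintegral_fderiv_sq_closedBall_le`):

* **`waitingTime_law_of_selfSimilarC2`** — crux hypotheses verbatim (`0 < ρ ≤ ½`) + exact self-similarity with a `C²`
  profile `V` ⇒ for every `m` there is `R₀ ≥ 1` such that for all `R ≥ R₀`, every cut-off copy `V'` of `V` beyond `2R`,
  every `S ≥ 0` and every measurable blob `B₀ ⊆ B̄_R`, the labels of `B₀` whose backward similarity orbit leaves
  `‖·‖ ≤ 2R` before time `S` have volume `≤ (4/R) · ((e^{3γS} − 1)/(3γ)) · √(R^{−m})`, `γ = 1/(2+ρ)` — THE ONE STATEMENT's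
  survivor feeds its vortical blobs through a «stretched waiting room»: backward feeding time `≳ (m/6γ) log R` for every `m`;
* **`selfSimilar_ae_eq_zero_of_logClockC2`** — the same member is TRIVIAL as soon as its profile carries a RESIDENCE CLOCK of
  strength `s₁ log R` (around every vortical point a ball at most half of whose labels stay in `‖·‖ ≤ 2R` during backward
  time `s₁ log R`, all large `R`, every cut-off copy): the typed threshold a symmetry-free monotone quantity must meet
  (the axisymmetric swirl-free Casimir meets it: `…NeedleAxisymNoSwirlMember`).

NOT NS, not E: a portrait and a conditional threshold for the general `C²` needle; 19832 OPEN.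
References: Constantin–Ignatova–Vicol arXiv:2602.17570 §3.4–§3.5 [ConstantinIgnatovaVicol2026Putative]; Maz'ya, Sobolev
Spaces §2.2.3 (capacity–area, behind t39b) [folklore].
-/

noncomputable section

-- the summit and its single problem share the name `NavierStokesRegularity` (D-0017 nested layout)
set_option linter.dupNamespace false

open Set Filter Topology Metric Function MeasureTheory InnerProductSpace
open scoped RealInnerProductSpace NNReal ENNReal

namespace Summit.NavierStokesRegularity.NavierStokesRegularity.Theorems.PowerGaugeEulerLiouville.NeedleRace

open Literature.Analysis Literature.Analysis.FluidPDE
open Summit.NavierStokesRegularity.NavierStokesRegularity.Theorems.PowerGaugeEulerLiouville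

variable {V : EuclideanSpace ℝ (Fin 3) → EuclideanSpace ℝ (Fin 3)}

/-- **The class data of an exactly self-similar `C²` member, in the shape (K′) consumes**: the exponent `γ = 1/(2+ρ)`,
the profile's divergence-freeness, and the general thin fast exits `NeedleFastSetMeasure.thinFastExits` on the class budgets
(`κ = 1`). [cite: ConstantinIgnatovaVicol2026Putative, §3.4.1 eq. (3.21)-(3.22)] -/
theorem thinFastExits_of_selfSimilarC2 {ρ : ℝ} (hρ : 0 < ρ) (hρ1 : ρ ≤ 1 / 2)
    {u : ℝ → EuclideanSpace ℝ (Fin 3) → EuclideanSpace ℝ (Fin 3)} {p : ℝ → EuclideanSpace ℝ (Fin 3) → ℝ}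
    {H : ℝ → EuclideanSpace ℝ (Fin 3) → EuclideanSpace ℝ (Fin 3) →L[ℝ] EuclideanSpace ℝ (Fin 3)} {c : ℝ≥0}
    (hsw : IsSuitableWeakSolutionOn (slab (EuclideanSpace ℝ (Fin 3)) (Iio 0) isOpen_Iio) 0 0 u p)
    (hH : HasWeakSpatialGradientOn (slab (EuclideanSpace ℝ (Fin 3)) (Iio 0) isOpen_Iio) u H)
    (hgauge : ∀ a : ℝ, 0 < a →
      ENNReal.ofReal (a ^ (2 * ρ)) * cknA a (0 : ℝ × EuclideanSpace ℝ (Fin 3)) u +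
          ENNReal.ofReal (a ^ ρ) * cknE a (0 : ℝ × EuclideanSpace ℝ (Fin 3)) H +
        ENNReal.ofReal (a ^ (2 * ρ)) * cknD a (0 : ℝ × EuclideanSpace ℝ (Fin 3)) p ≤ (c : ℝ≥0∞))
    {P : EuclideanSpace ℝ (Fin 3) → ℝ}
    (hu : ∀ τ : ℝ, τ < 0 → u τ = selfSimilarCollapse (1 / (2 + ρ)) 0 V τ)
    (hp : ∀ τ : ℝ, τ < 0 → p τ = selfSimilarCollapsePressure (1 / (2 + ρ)) 0 P τ)
    (hV : ContDiff ℝ 2 V) :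
    VectorCalculus.IsDivFree V ∧
      ∀ m : ℝ, ∃ R₀ : ℝ, ∀ R : ℝ, R₀ ≤ R →
        ∃ (G : Set ℝ) (N : Set (EuclideanSpace ℝ (Fin 3))),
          MeasurableSet G ∧ G ⊆ Icc (R ^ 2) ((2 * R) ^ 2) ∧ 1 * R ^ 2 ≤ (volume G).toReal ∧
          MeasurableSet N ∧ N ⊆ closedBall (0 : EuclideanSpace ℝ (Fin 3)) (2 * R) ∧
          (∀ z : EuclideanSpace ℝ (Fin 3), ‖z‖ ^ 2 ∈ G →
            ⟪V z, z⟫ + 1 / (2 + ρ) * ‖z‖ ^ 2 < 0 → z ∈ N) ∧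
          volume N * ∫⁻ z in N, ENNReal.ofReal (‖V z‖ ^ 2) ≤ ENNReal.ofReal (R ^ (-m)) := by
  have hρ1' : ρ < 1 := by linarith
  have h2ρ : (0 : ℝ) < 2 + ρ := by linarith
  have hγ : (0 : ℝ) < 1 / (2 + ρ) := one_div_pos.2 h2ρ
  have h1ρ : 0 ≤ 1 - ρ := by linarith
  -- divergence-free
  have hdivw : IsWeaklyDivFree V :=
    ProfileEquation.profile_isWeaklyDivFree hsw.distributional hu hV.continuous.locallyIntegrable
  have hdiv : VectorCalculus.IsDivFree V := hdivw.isDivFree_of_contDiff (hV.of_le (by norm_num))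
  -- the class budgets of the profile
  obtain ⟨hA', hE'⟩ :=
    NeedleThinCore.selfSimilar_needle_inputs hρ hρ1' hsw hH hgauge hu hp (hV.of_le one_le_two)
  have hbA : ∀ L : ℝ, 1 ≤ L →
      ∫⁻ z in closedBall (0 : EuclideanSpace ℝ (Fin 3)) L, ‖V z‖ₑ ^ 2 ≤
        ENNReal.ofReal ((c : ℝ) * 2 ^ (1 - 2 * ρ) * L ^ (1 - 2 * ρ)) := by
    intro L hL
    have hL0 : 0 < L := by linarith
    calc ∫⁻ z in closedBall (0 : EuclideanSpace ℝ (Fin 3)) L, ‖V z‖ₑ ^ 2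
        ≤ ∫⁻ z in ball (0 : EuclideanSpace ℝ (Fin 3)) (2 * L), ‖V z‖ₑ ^ 2 :=
          lintegral_mono_set (closedBall_subset_ball (by linarith))
      _ ≤ (c : ℝ≥0∞) * ENNReal.ofReal ((2 * L) ^ (1 - 2 * ρ)) := hA' (2 * L) (by linarith)
      _ = ENNReal.ofReal ((c : ℝ) * 2 ^ (1 - 2 * ρ) * L ^ (1 - 2 * ρ)) := by
          rw [Real.mul_rpow two_pos.le hL0.le, ← ENNReal.ofReal_coe_nnreal,
            ← ENNReal.ofReal_mul (NNReal.coe_nonneg c)]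
          congr 1
          ring
  have hE0 : 0 ≤ (1 - ρ) / (2 + ρ) * (c : ℝ) := by positivity
  have hbE : ∀ L : ℝ, 1 ≤ L →
      ∫⁻ z in closedBall (0 : EuclideanSpace ℝ (Fin 3)) L, ‖fderiv ℝ V z‖ₑ ^ 2 ≤
        ENNReal.ofReal ((1 - ρ) / (2 + ρ) * (c : ℝ) * L ^ (1 - ρ)) :=
    fun L hL => lintegral_fderiv_sq_closedBall_le hρ1' hE0 hE' hL
  exact ⟨hdiv, NeedleFastSetMeasure.thinFastExits (hV.of_le (by norm_num)) hγ hρ.le (by positivity) hE0 hbA hbE⟩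

/-- **THE GENERAL-3-D WAITING-TIME LAW AT MEMBER LEVEL (ROUND-38 (W)).**  See the module docstring.
[cite: ConstantinIgnatovaVicol2026Putative, §3.4.1 eq. (3.21)-(3.22), §3.5] -/
theorem waitingTime_law_of_selfSimilarC2 {ρ : ℝ} (hρ : 0 < ρ) (hρ1 : ρ ≤ 1 / 2)
    {u : ℝ → EuclideanSpace ℝ (Fin 3) → EuclideanSpace ℝ (Fin 3)} {p : ℝ → EuclideanSpace ℝ (Fin 3) → ℝ}
    {H : ℝ → EuclideanSpace ℝ (Fin 3) → EuclideanSpace ℝ (Fin 3) →L[ℝ] EuclideanSpace ℝ (Fin 3)} {c : ℝ≥0}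
    (hsw : IsSuitableWeakSolutionOn (slab (EuclideanSpace ℝ (Fin 3)) (Iio 0) isOpen_Iio) 0 0 u p)
    (hH : HasWeakSpatialGradientOn (slab (EuclideanSpace ℝ (Fin 3)) (Iio 0) isOpen_Iio) u H)
    (hgauge : ∀ a : ℝ, 0 < a →
      ENNReal.ofReal (a ^ (2 * ρ)) * cknA a (0 : ℝ × EuclideanSpace ℝ (Fin 3)) u +
          ENNReal.ofReal (a ^ ρ) * cknE a (0 : ℝ × EuclideanSpace ℝ (Fin 3)) H +
        ENNReal.ofReal (a ^ (2 * ρ)) * cknD a (0 : ℝ × EuclideanSpace ℝ (Fin 3)) p ≤ (c : ℝ≥0∞))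
    {P : EuclideanSpace ℝ (Fin 3) → ℝ}
    (hu : ∀ τ : ℝ, τ < 0 → u τ = selfSimilarCollapse (1 / (2 + ρ)) 0 V τ)
    (hp : ∀ τ : ℝ, τ < 0 → p τ = selfSimilarCollapsePressure (1 / (2 + ρ)) 0 P τ)
    (hV : ContDiff ℝ 2 V) (m : ℝ) :
    ∃ R₀ : ℝ, 1 ≤ R₀ ∧ ∀ R : ℝ, R₀ ≤ R →
      ∀ {V' : EuclideanSpace ℝ (Fin 3) → EuclideanSpace ℝ (Fin 3)}, ContDiff ℝ 2 V' →
      ∀ {K : ℝ}, (∀ y, ‖fderiv ℝ V' y‖ ≤ K) →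
      ∀ {Rbig : ℝ}, 2 * R < Rbig → (∀ w ∈ ball (0 : EuclideanSpace ℝ (Fin 3)) Rbig, V' w = V w) →
      ∀ {S : ℝ}, 0 ≤ S →
      ∀ {B₀ : Set (EuclideanSpace ℝ (Fin 3))}, MeasurableSet B₀ →
        B₀ ⊆ closedBall (0 : EuclideanSpace ℝ (Fin 3)) R →
        (volume (B₀ \ {y | ∀ σ ∈ Icc 0 S,
            ‖ODE.evolutionMap (fun _ : ℝ => selfSimilarTransport (1 / (2 + ρ)) 0 V') 0 (-σ) y‖ ≤ 2 * R})).toReal ≤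
          4 / R * ((Real.exp (3 * (1 / (2 + ρ)) * S) - 1) / (3 * (1 / (2 + ρ)))) * Real.sqrt (R ^ (-m)) := by
  have h2ρ : (0 : ℝ) < 2 + ρ := by linarith
  have hγ : (0 : ℝ) < 1 / (2 + ρ) := one_div_pos.2 h2ρ
  obtain ⟨hdiv, hthin⟩ := thinFastExits_of_selfSimilarC2 hρ hρ1 hsw hH hgauge hu hp hV
  obtain ⟨R₀, hR₀1, hR₀⟩ := volume_exit_toReal_le_of_thinFastExits (γ := 1 / (2 + ρ)) hdiv hγ one_pos hthin m
  refine ⟨R₀, hR₀1, ?_⟩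
  intro R hR V' hV' K hK Rbig hRbig hVU S hS B₀ hB₀m hB₀R
  have h := hR₀ R hR hV' hK hRbig hVU hS hB₀m hB₀R
  simpa only [one_mul] using h

/-- **THE LOG-CLOCK THRESHOLD AT MEMBER LEVEL (ROUND-38 (T_log) ∘ (K′)).**  An exactly self-similar member of the window
class (`0 < ρ ≤ ½`, crux hypotheses verbatim) with a `C²` profile carrying a RESIDENCE CLOCK of strength `s₁ log R`
(`s₁ ≥ 0`; the hypothesis `hclock`, for every cut-off copy of the profile beyond `2R`) is trivial. [cite: ConstantinIgnatovaVicol2026Putative, §3.5] -/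
theorem selfSimilar_ae_eq_zero_of_logClockC2 {ρ : ℝ} (hρ : 0 < ρ) (hρ1 : ρ ≤ 1 / 2)
    {u : ℝ → EuclideanSpace ℝ (Fin 3) → EuclideanSpace ℝ (Fin 3)} {p : ℝ → EuclideanSpace ℝ (Fin 3) → ℝ}
    {H : ℝ → EuclideanSpace ℝ (Fin 3) → EuclideanSpace ℝ (Fin 3) →L[ℝ] EuclideanSpace ℝ (Fin 3)} {c : ℝ≥0}
    (hsw : IsSuitableWeakSolutionOn (slab (EuclideanSpace ℝ (Fin 3)) (Iio 0) isOpen_Iio) 0 0 u p)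
    (hH : HasWeakSpatialGradientOn (slab (EuclideanSpace ℝ (Fin 3)) (Iio 0) isOpen_Iio) u H)
    (hgauge : ∀ a : ℝ, 0 < a →
      ENNReal.ofReal (a ^ (2 * ρ)) * cknA a (0 : ℝ × EuclideanSpace ℝ (Fin 3)) u +
          ENNReal.ofReal (a ^ ρ) * cknE a (0 : ℝ × EuclideanSpace ℝ (Fin 3)) H +
        ENNReal.ofReal (a ^ (2 * ρ)) * cknD a (0 : ℝ × EuclideanSpace ℝ (Fin 3)) p ≤ (c : ℝ≥0∞))
    {P : EuclideanSpace ℝ (Fin 3) → ℝ}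
    (hu : ∀ τ : ℝ, τ < 0 → u τ = selfSimilarCollapse (1 / (2 + ρ)) 0 V τ)
    (hp : ∀ τ : ℝ, τ < 0 → p τ = selfSimilarCollapsePressure (1 / (2 + ρ)) 0 P τ)
    (hV : ContDiff ℝ 2 V) {s₁ : ℝ} (hs₁ : 0 ≤ s₁)
    (hclock : ∀ x₀ : EuclideanSpace ℝ (Fin 3), curl V x₀ ≠ 0 → ∃ r : ℝ, 0 < r ∧ ∃ R₀ : ℝ, ∀ R : ℝ, R₀ ≤ R →
      ∀ (V' : EuclideanSpace ℝ (Fin 3) → EuclideanSpace ℝ (Fin 3)) (K Rbig : ℝ), ContDiff ℝ 2 V' →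
        (∀ y, ‖fderiv ℝ V' y‖ ≤ K) → 2 * R < Rbig →
        (∀ w ∈ ball (0 : EuclideanSpace ℝ (Fin 3)) Rbig, V' w = V w) →
        (volume (ball x₀ r ∩ {y | ∀ σ ∈ Icc 0 (s₁ * Real.log R),
          ‖ODE.evolutionMap (fun _ : ℝ => selfSimilarTransport (1 / (2 + ρ)) 0 V') 0 (-σ) y‖ ≤ 2 * R})).toReal ≤
          (volume (ball x₀ r)).toReal / 2) :
    uncurry u =ᵐ[volume.restrict (Iio (0 : ℝ) ×ˢ (univ : Set (EuclideanSpace ℝ (Fin 3))))] 0 := by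
  have h2ρ : (0 : ℝ) < 2 + ρ := by linarith
  have hγ : (0 : ℝ) < 1 / (2 + ρ) := one_div_pos.2 h2ρ
  have hA : ∀ a : ℝ, 0 < a → ENNReal.ofReal (a ^ (2 * ρ)) *
      cknA a (0 : ℝ × EuclideanSpace ℝ (Fin 3)) u ≤ (c : ℝ≥0∞) :=
    fun a ha => le_trans (le_trans le_self_add le_self_add) (hgauge a ha)
  obtain ⟨hdiv, hthin⟩ := thinFastExits_of_selfSimilarC2 hρ hρ1 hsw hH hgauge hu hp hV
  have hc0 : ∀ x, curl V x = 0 :=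
    curl_eq_zero_of_logClock_of_thinFastExits (γ := 1 / (2 + ρ)) hV hdiv hγ one_pos hthin hs₁ hclock
  exact Loc.selfSimilar_ae_eq_zero_of_irrotationalC2_profile hρ hsw.distributional hA hu hV hc0

end Summit.NavierStokesRegularity.NavierStokesRegularity.Theorems.PowerGaugeEulerLiouville.NeedleRace

end
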